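import Literature.NumberTheory.LFunctions.WeilTwoPrimeCellsT80
import Literature.NumberTheory.LFunctions.WeilTwoPrimeMinorant
import Literature.NumberTheory.LFunctions.WeilTwoPrimeCellsT80NuPart0
import HarnessLib

/-!
# Two-prime minorant cells on `[0, 80]`: kernel facts for the partial moment sums, group 1

`cellsMomentQ₂₃ wL chunk q = nuPartT80_t_q` by `decide +kernel`, one declaration per (chunk, q). Pure proof file.
-/

noncomputable section

namespace Literature.NumberTheory.LFunctions

set_option maxHeartbeats 0 in
/-- The partial moment sum over chunk 0 at `q = 4`. [folklore] -/
theorem nuPartT80_0_4_eq :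
    cellsMomentQ₂₃ weilTwoPrimeCellsT80Level weilTwoPrimeCellsT80C0 4 = nuPartT80_0_4 := by
  decide +kernel

set_option maxHeartbeats 0 in
/-- The partial moment sum over chunk 1 at `q = 4`. [folklore] -/
theorem nuPartT80_1_4_eq :
    cellsMomentQ₂₃ weilTwoPrimeCellsT80Level (weilTwoPrimeCellsT80C1.take 53) 4 = nuPartT80_1_4 := by
  decide +kernel

set_option maxHeartbeats 0 in
/-- The partial moment sum over chunk 2 at `q = 4`. [folklore] -/
theorem nuPartT80_2_4_eq :
    cellsMomentQ₂₃ weilTwoPrimeCellsT80Level (weilTwoPrimeCellsT80C1.drop 53) 4 = nuPartT80_2_4 := by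
  decide +kernel

set_option maxHeartbeats 0 in
/-- The partial moment sum over chunk 3 at `q = 4`. [folklore] -/
theorem nuPartT80_3_4_eq :
    cellsMomentQ₂₃ weilTwoPrimeCellsT80Level weilTwoPrimeCellsT80C2 4 = nuPartT80_3_4 := by
  decide +kernel

set_option maxHeartbeats 0 in
/-- The partial moment sum over chunk 0 at `q = 6`. [folklore] -/
theorem nuPartT80_0_6_eq :
    cellsMomentQ₂₃ weilTwoPrimeCellsT80Level weilTwoPrimeCellsT80C0 6 = nuPartT80_0_6 := by
  decide +kernel

set_option maxHeartbeats 0 in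
/-- The partial moment sum over chunk 1 at `q = 6`. [folklore] -/
theorem nuPartT80_1_6_eq :
    cellsMomentQ₂₃ weilTwoPrimeCellsT80Level (weilTwoPrimeCellsT80C1.take 53) 6 = nuPartT80_1_6 := by
  decide +kernel

set_option maxHeartbeats 0 in
/-- The partial moment sum over chunk 2 at `q = 6`. [folklore] -/
theorem nuPartT80_2_6_eq :
    cellsMomentQ₂₃ weilTwoPrimeCellsT80Level (weilTwoPrimeCellsT80C1.drop 53) 6 = nuPartT80_2_6 := by
  decide +kernel

set_option maxHeartbeats 0 in
/-- The partial moment sum over chunk 3 at `q = 6`. [folklore] -/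
theorem nuPartT80_3_6_eq :
    cellsMomentQ₂₃ weilTwoPrimeCellsT80Level weilTwoPrimeCellsT80C2 6 = nuPartT80_3_6 := by
  decide +kernel


end Literature.NumberTheory.LFunctions
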